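import Summits.BirchSwinnertonDyer.BirchSwinnertonDyer.Theorems.ClassRecordThreeEulerHalvesAtThreeCartanSupplyCubicV1
import Literature.NumberTheory.NumberFields.EisensteinFieldPrimes
import HarnessLib

/-!
# Eisenstein descent on `V₁`, I: the operators `R`, `T`, `S₀ = (a + bR)T` and the lattice `L = {v ∈ V₁ : S₀ v = q v}`

Helper file `--supports stmt-BirchSwinnertonDyer-23422` (seat `bsd-stepL-tam3-p1` g23, LINE OWNER of crux 23422, line `cartan` v11), serving the registered
stub (SUPPLY) `stub_cartanTorusLatticeSupply` (memo `HOME/tam3-p1/g23/SUPPLY-ROAD-GG1.md` §2), continuing `…CubicV1`. For `q ≡ 1 (mod 3)` fix a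
non-cube `ζ` (`zeta`) and an EISENSTEIN PAIR `(a, b)`, `a² − ab + b² = q`, normalised by `a + b ≡ 2 (mod 3)` (`eis`; from the tree's
`Literature…K3.exists_norm_eq_of_mod_three_eq_one`, the sign flipped if needed). On `ℤ[X]`: `R = sc ζ` with `R³ = 1` (`R_R_R`), the Hecke operator
`T` with `TR = R²T` (`hecke_R`), and the INTEGRAL DESCENT OPERATOR `S₀ = aT + bRT` (`S0`; `S₀ = q·S` for the semilinear involution `S = x̄⁻¹T` of the
memo). On `V₁` (`…CubicV1.V1`, stable under `R`, `T`, `S₀`): `1 + R + R² = 0`, `T² = q`, hence `S₀² = q²` (`S0_S0`), `S₀R = R²S₀` (`S0_R`),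
`S₀θ = −θS₀` for `θ = R − R²` (`S0_theta`) and `θ² = −3` (`theta_theta`). The lattice **`L = V₁ ⊓ ker(S₀ − q)`** (`latL`, `mem_latL_iff`) is
`G`-stable (`act_mem_latL`, `actL`); Part II shows `V₁ ≈ L ⊕ RL` up to index `3q` and `tr(g | L) = χ_W(g)`.
HONEST FRAMING: linear algebra over `ℤ`; nothing about SUPPLY, NUM, crux 23422 ∕ 19109 is proved here; BSD is proved for no curve. [folklore]
-/

namespace Summit.BirchSwinnertonDyer.BirchSwinnertonDyer.Theorems.CartanSupply.CubicDescent

open Summit.BirchSwinnertonDyer.BirchSwinnertonDyer.Theorems.CartanDegree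
open Summit.BirchSwinnertonDyer.BirchSwinnertonDyer.Theorems.CartanTorusCubeCut
open Summit.BirchSwinnertonDyer.BirchSwinnertonDyer.Theorems.CartanSupply.CubicClasses
open Summit.BirchSwinnertonDyer.BirchSwinnertonDyer.Theorems.CartanSupply.CubicHecke
open Summit.BirchSwinnertonDyer.BirchSwinnertonDyer.Theorems.CartanSupply.CubicFibres
open Summit.BirchSwinnertonDyer.BirchSwinnertonDyer.Theorems.CartanSupply.CubicV1

set_option linter.dupNamespace false
set_option autoImplicit false

open scoped Classical

variable {q : ℕ} [Fact q.Prime]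

/-! ## §1 The choices: a non-cube `ζ` and a normalised Eisenstein pair `(a, b)` -/

/-- PROVED (`q ≡ 1 (3)`): an Eisenstein pair `a² − ab + b² = q` with `a + b ≡ 2 (mod 3)` exists. [cite: IrelandRosen1990, Prop. 9.1.4] -/
theorem exists_eis (h1 : q % 3 = 1) : ∃ ab : ℤ × ℤ, ab.1 ^ 2 - ab.1 * ab.2 + ab.2 ^ 2 = q ∧ (ab.1 + ab.2) % 3 = 2 := by
  obtain ⟨a, b, h⟩ := Literature.NumberTheory.NumberFields.K3.exists_norm_eq_of_mod_three_eq_one (Fact.out : q.Prime) h1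
  have hq : ((q : ℕ) : ℤ) % 3 = 1 := by omega
  have hsq : (a + b) ^ 2 % 3 = 1 := by
    have : (a + b) ^ 2 = (q : ℤ) + 3 * (a * b) := by rw [← h]; ring
    rw [this, Int.add_mul_emod_self_left]
    exact_mod_cast hq
  have h3 : (a + b) % 3 = 1 ∨ (a + b) % 3 = 2 := by
    have h0 : 0 ≤ (a + b) % 3 := Int.emod_nonneg _ (by norm_num)
    have h3' : (a + b) % 3 < 3 := Int.emod_lt_of_pos _ (by norm_num)
    have key : ((a + b) % 3 * ((a + b) % 3)) % 3 = 1 := by rw [← Int.mul_emod, ← pow_two]; exact hsq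
    rcases (by omega : (a + b) % 3 = 0 ∨ (a + b) % 3 = 1 ∨ (a + b) % 3 = 2) with h0 | h1' | h2'
    · rw [h0] at key; norm_num at key
    · exact Or.inl h1'
    · exact Or.inr h2'
  rcases h3 with h3 | h3
  · refine ⟨(-a, -b), by simpa [neg_mul_neg] using (by rw [← h]; ring : (-a) ^ 2 - (-a) * (-b) + (-b) ^ 2 = (q : ℤ)), ?_⟩
    show (-a + -b) % 3 = 2
    omega
  · exact ⟨(a, b), h, h3⟩

/-- A non-cube unit (`q ≡ 1 (3)`). -/
noncomputable def zeta (h1 : q % 3 = 1) : (ZMod q)ˣ := Classical.choose (exists_nonCube h1)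

/-- PROVED: `ζ ∉ K`. [folklore] -/
theorem zeta_not_mem (h1 : q % 3 = 1) : zeta h1 ∉ cubes q := Classical.choose_spec (exists_nonCube h1)

/-- The normalised Eisenstein pair `(a, b)`. -/
noncomputable def eis (h1 : q % 3 = 1) : ℤ × ℤ := Classical.choose (exists_eis h1)

/-- PROVED: `a² − ab + b² = q`. [folklore] -/
theorem eis_norm (h1 : q % 3 = 1) : (eis h1).1 ^ 2 - (eis h1).1 * (eis h1).2 + (eis h1).2 ^ 2 = q := (Classical.choose_spec (exists_eis h1)).1

/-- PROVED: `a + b ≡ 2 (mod 3)`. [folklore] -/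
theorem eis_mod (h1 : q % 3 = 1) : ((eis h1).1 + (eis h1).2) % 3 = 2 := (Classical.choose_spec (exists_eis h1)).2

/-! ## §2 The operators `R`, `T`, `S₀` on `ℤ[X]` -/

/-- The scaling `R = sc ζ`. -/
noncomputable def R (h1 : q % 3 = 1) : (X q → ℤ) →ₗ[ℤ] (X q → ℤ) := sc ℤ (zeta h1)

/-- The integral descent operator `S₀ = aT + bRT`. -/
noncomputable def S0 (h1 : q % 3 = 1) : (X q → ℤ) →ₗ[ℤ] (X q → ℤ) := (eis h1).1 • hecke ℤ + (eis h1).2 • (R h1 ∘ₗ hecke ℤ)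

/-- PROVED: unfolding. [folklore] -/
theorem S0_apply (h1 : q % 3 = 1) (φ : X q → ℤ) : S0 h1 φ = (eis h1).1 • hecke ℤ φ + (eis h1).2 • R h1 (hecke ℤ φ) := rfl

/-- PROVED: for any unit `u`, `sc u⁻¹ = sc u ∘ sc u` (`u³ ∈ K`). [folklore] -/
theorem sc_inv_eq (u : (ZMod q)ˣ) : sc ℤ u⁻¹ = sc ℤ u ∘ₗ (sc ℤ u : (X q → ℤ) →ₗ[ℤ] (X q → ℤ)) := by
  have h3 : u ^ 3 ∈ cubes q := (mem_cubes_iff _).mpr ⟨u, rfl⟩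
  rw [show u⁻¹ = u * u * (u ^ 3)⁻¹ by group, sc_mul, sc_mul, sc_of_mem ℤ ((cubes q).inv_mem h3), LinearMap.comp_id]

/-- PROVED: `R³ = 1`. [folklore] -/
theorem R_R_R (h1 : q % 3 = 1) (φ : X q → ℤ) : R h1 (R h1 (R h1 φ)) = φ := by
  have h3 : zeta h1 ^ 3 ∈ cubes q := (mem_cubes_iff _).mpr ⟨zeta h1, rfl⟩
  have h := sc_of_mem (A := ℤ) h3
  rw [pow_three, sc_mul, sc_mul] at h
  exact LinearMap.congr_fun h φ

/-- PROVED: `TR = R²T`. [folklore] -/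
theorem hecke_R (h1 : q % 3 = 1) (φ : X q → ℤ) : hecke ℤ (R h1 φ) = R h1 (R h1 (hecke ℤ φ)) := by
  have h := LinearMap.congr_fun (hecke_comp_sc ℤ (zeta h1)) φ
  rw [LinearMap.comp_apply, LinearMap.comp_apply, sc_inv_eq, LinearMap.comp_apply] at h
  exact h

/-- PROVED: `TR² = RT`. [folklore] -/
theorem hecke_R_R (h1 : q % 3 = 1) (φ : X q → ℤ) : hecke ℤ (R h1 (R h1 φ)) = R h1 (hecke ℤ φ) := by
  rw [hecke_R, hecke_R, R_R_R]

/-- PROVED: `S₀R = R²S₀`. [folklore] -/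
theorem S0_R (h1 : q % 3 = 1) (φ : X q → ℤ) : S0 h1 (R h1 φ) = R h1 (R h1 (S0 h1 φ)) := by
  rw [S0_apply, S0_apply, hecke_R, R_R_R, map_add, map_add, map_smul, map_smul, map_smul, map_smul, R_R_R]

/-- PROVED: `S₀θ = −θS₀` with `θ = R − R²`: `S₀(Rφ − R²φ) = R²S₀φ − RS₀φ`. [folklore] -/
theorem S0_theta (h1 : q % 3 = 1) (φ : X q → ℤ) :
    S0 h1 (R h1 φ - R h1 (R h1 φ)) = R h1 (R h1 (S0 h1 φ)) - R h1 (S0 h1 φ) := by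
  rw [map_sub, S0_R, S0_R, S0_R, R_R_R]

/-- PROVED: the action commutes with `R`. [folklore] -/
theorem act_R (h1 : q % 3 = 1) (g : G q) (φ : X q → ℤ) : act ℤ g (R h1 φ) = R h1 (act ℤ g φ) := by
  have h := LinearMap.congr_fun (act_comp_sc ℤ g (zeta h1)) φ
  rw [LinearMap.comp_apply, LinearMap.comp_apply] at h
  exact h

/-- PROVED: the action commutes with `T`. [folklore] -/
theorem act_hecke (g : G q) (φ : X q → ℤ) : act ℤ g (hecke ℤ φ) = hecke ℤ (act ℤ g φ) := by
  have h := LinearMap.congr_fun (hecke_comp_act ℤ g) φ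
  rw [LinearMap.comp_apply, LinearMap.comp_apply] at h
  exact h.symm

/-- PROVED: the action commutes with `S₀`. [folklore] -/
theorem act_S0 (h1 : q % 3 = 1) (g : G q) (φ : X q → ℤ) : act ℤ g (S0 h1 φ) = S0 h1 (act ℤ g φ) := by
  rw [S0_apply, S0_apply, map_add, map_smul, map_smul, act_hecke, act_R, act_hecke]

/-! ## §3 On `V₁`: `1 + R + R² = 0`, `T² = q`, stability, `S₀² = q²`, `θ² = −3` -/

/-- PROVED: the total mass of a fibre-sum-zero function vanishes. [folklore] -/
theorem sum_eq_zero_of_mem_V1 {φ : X q → ℤ} (hφ : φ ∈ V1 q) : ∑ x, φ x = 0 := by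
  rw [mem_V1_iff] at hφ
  rw [← Finset.sum_fiberwise_of_maps_to (s := Finset.univ) (t := Finset.univ.image (toP1 : X q → Steinberg.P1 q))
    (g := fun z : X q => toP1 z) (fun z hz => Finset.mem_image_of_mem _ hz)]
  exact Finset.sum_eq_zero fun p _ => hφ p

/-- PROVED: `V₁` is stable under every scaling. [folklore] -/
theorem sc_mem_V1 (u : (ZMod q)ˣ) {φ : X q → ℤ} (hφ : φ ∈ V1 q) : sc ℤ u φ ∈ V1 q := by
  rw [mem_V1_iff] at hφ ⊢
  intro p
  rw [Finset.sum_filter]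
  simp only [sc_apply]
  rw [← Equiv.sum_comp (ρX u) (fun x => if toP1 x = p then φ (ρX u⁻¹ x) else 0)]
  have h1' : ∀ z : X q, ρX u⁻¹ (ρX u z) = z := fun z => by
    rw [← Equiv.Perm.mul_apply, ← ρX_mul, inv_mul_cancel, ρX_one, Equiv.Perm.one_apply]
  simp only [h1', toP1_ρX]
  rw [← Finset.sum_filter]
  exact hφ p

/-- PROVED: `R V₁ ⊂ V₁`. [folklore] -/
theorem R_mem_V1 (h1 : q % 3 = 1) {φ : X q → ℤ} (hφ : φ ∈ V1 q) : R h1 φ ∈ V1 q := sc_mem_V1 (zeta h1) hφ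

/-- PROVED: `T V₁ ⊂ V₁`. [folklore] -/
theorem hecke_mem_V1 {φ : X q → ℤ} (hφ : φ ∈ V1 q) : hecke ℤ φ ∈ V1 q := by
  have h0 := sum_eq_zero_of_mem_V1 hφ
  rw [mem_V1_iff] at hφ ⊢
  intro p
  obtain ⟨x₀, rfl⟩ := toP1_surjective p
  rw [fibreSum_hecke, h0, hφ, sub_zero]

/-- PROVED: `S₀ V₁ ⊂ V₁`. [folklore] -/
theorem S0_mem_V1 (h1 : q % 3 = 1) {φ : X q → ℤ} (hφ : φ ∈ V1 q) : S0 h1 φ ∈ V1 q := by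
  rw [S0_apply]
  exact (V1 q).add_mem ((V1 q).smul_mem _ (hecke_mem_V1 hφ)) ((V1 q).smul_mem _ (R_mem_V1 h1 (hecke_mem_V1 hφ)))

/-- PROVED — **`1 + R + R² = 0` on `V₁`**. [folklore] -/
theorem one_R_R2 (h1 : q % 3 = 1) {φ : X q → ℤ} (hφ : φ ∈ V1 q) : φ + R h1 φ + R h1 (R h1 φ) = 0 :=
  add_sc_add_sc_sc_eq_zero h1 (zeta_not_mem h1) ℤ φ ((mem_V1_iff φ).mp hφ)

/-- PROVED — **`T² = q` on `V₁`**. [folklore] -/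
theorem hecke_hecke {φ : X q → ℤ} (hφ : φ ∈ V1 q) : hecke ℤ (hecke ℤ φ) = (q : ℤ) • φ :=
  hecke_hecke_of_fibreSumZero ℤ φ ((mem_V1_iff φ).mp hφ)

/-- PROVED — **`S₀² = q²` on `V₁`** (the norm equation `a² − ab + b² = q`). [folklore] -/
theorem S0_S0 (h1 : q % 3 = 1) {φ : X q → ℤ} (hφ : φ ∈ V1 q) : S0 h1 (S0 h1 φ) = ((q : ℤ) * q) • φ := by
  have hT : hecke ℤ (S0 h1 φ) = (q : ℤ) • ((eis h1).1 • φ + (eis h1).2 • R h1 (R h1 φ)) := by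
    rw [S0_apply, map_add, map_smul, map_smul, hecke_R, hecke_hecke hφ, map_smul, map_smul, smul_add, smul_comm,
      smul_comm ((eis h1).2)]
  have hrel := one_R_R2 h1 hφ
  have hnorm := eis_norm h1
  rw [S0_apply, hT, map_smul, map_add, map_smul, map_smul, R_R_R]
  -- `a q (a φ + b R²φ) + b q (a Rφ + b φ)` with `Rφ + R²φ = −φ`
  have hR : R h1 φ = -φ - R h1 (R h1 φ) := by rw [eq_sub_iff_add_eq, eq_neg_iff_add_eq_zero, add_comm, ← add_assoc]; exact hrel
  set ψ := R h1 (R h1 φ) with hψ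
  rw [hR]
  have : ((q : ℤ) * q) • φ = ((q : ℤ) * ((eis h1).1 ^ 2 - (eis h1).1 * (eis h1).2 + (eis h1).2 ^ 2)) • φ := by rw [hnorm]
  rw [this]
  module

/-- PROVED — **`θ² = −3` on `V₁`** (`θ = R − R²`). [folklore] -/
theorem theta_theta (h1 : q % 3 = 1) {φ : X q → ℤ} (hφ : φ ∈ V1 q) :
    R h1 (R h1 φ - R h1 (R h1 φ)) - R h1 (R h1 (R h1 φ - R h1 (R h1 φ))) = (-3 : ℤ) • φ := by
  have hrel := one_R_R2 h1 hφ
  simp only [map_sub, R_R_R]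
  have hR2 : R h1 (R h1 φ) = -φ - R h1 φ := by
    rw [eq_sub_iff_add_eq, eq_neg_iff_add_eq_zero]
    rw [← hrel]; abel
  rw [hR2]
  module

/-! ## §4 The lattice `L = V₁ ⊓ ker(S₀ − q)` -/

/-- The descended lattice `L = {φ ∈ V₁ : S₀ φ = q φ}`. -/
noncomputable def latL (h1 : q % 3 = 1) : Submodule ℤ (X q → ℤ) := V1 q ⊓ LinearMap.ker (S0 h1 - (q : ℤ) • LinearMap.id)

/-- PROVED: membership. [folklore] -/
theorem mem_latL_iff (h1 : q % 3 = 1) (φ : X q → ℤ) : φ ∈ latL h1 ↔ φ ∈ V1 q ∧ S0 h1 φ = (q : ℤ) • φ := by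
  rw [latL, Submodule.mem_inf, LinearMap.mem_ker, LinearMap.sub_apply, LinearMap.smul_apply, LinearMap.id_apply, sub_eq_zero]

/-- PROVED: `L` is `G`-stable. [folklore] -/
theorem act_mem_latL (h1 : q % 3 = 1) (g : G q) : ∀ φ ∈ latL h1, act ℤ g φ ∈ latL h1 := by
  intro φ hφ
  rw [mem_latL_iff] at hφ ⊢
  exact ⟨act_mem_V1 g φ hφ.1, by rw [← act_S0, hφ.2, map_smul]⟩

/-- The action on `L`. -/
noncomputable def actL (h1 : q % 3 = 1) (g : G q) : latL h1 →ₗ[ℤ] latL h1 := (act ℤ g).restrict (act_mem_latL h1 g)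

end Summit.BirchSwinnertonDyer.BirchSwinnertonDyer.Theorems.CartanSupply.CubicDescent
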